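import Mathlib

/-!
# Two-arm gluing for the chordless two-type inequality, I: finite-set preliminaries

Support file (`--supports stmt-CriticalPhenomena-4575`, closed), prover `prim-cplus-coupling` (gen 71).  No definitions, no named
facts, no sorries; standard axioms.  Memo `prim-cplus-coupling/A5-COUPLING-gen71.md` §2.  Companions: `…KernelMixTwoArmsCore`
(the oriented case analysis) and `…KernelMixTwoArms` (the theorem).

Elementary facts about a finite preorder with least element `b`, greatest element `t` and a 'mirror' involution `c` with
`c b = t`: upper families through `b` are everything, nonempty upper (lower) families contain `t` (`b`), the mirror set
`{x | c x ∈ D}` has `#D` elements, contains `t` iff `b ∈ D`, and avoids `b` if `D` avoids `t`; and the two counting lemmas of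
the gluing argument: **monotonicity of credits** (`credits_mono`: the three disjoint credit families `(A∖C)∩T₁`, `(C∖A)∩T₂`,
`A∩C∩NE` of a pair of upper families grow, as a union, with `(A, C)` when `T₁, T₂ ⊆ NE`) and the apex count
(`card_three_le_erase_add_one`).
[cite: KozmaNitzan2024, Questions 8–9 (§5.5 p. 36) (context); Harris 1960; Kleitman 1966]
-/

namespace Summit.CriticalPhenomena.PercolationContinuityZ3.Theorems.Coefficientwise.TwoArms

open Finset

variable {X : Type*}

/-- An upper family containing the least element is everything. -/
theorem upper_eq_univ_of_bot_mem [Fintype X] [Preorder X] {A : Finset X} (hA : IsUpperSet (A : Set X)) {b : X} (hb : ∀ x, b ≤ x) (hbA : b ∈ A) :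
    A = univ := by
  ext x
  simp only [mem_univ, iff_true]
  exact mem_coe.mp (hA (hb x) (mem_coe.mpr hbA))

/-- A nonempty upper family contains the greatest element. -/
theorem top_mem_of_upper_nonempty [Preorder X] {A : Finset X} (hA : IsUpperSet (A : Set X)) {t : X} (ht : ∀ x, x ≤ t)
    (hne : A.Nonempty) : t ∈ A := by
  obtain ⟨x, hx⟩ := hne
  exact mem_coe.mp (hA (ht x) (mem_coe.mpr hx))

/-- A nonempty lower family contains the least element. -/
theorem bot_mem_of_lower_nonempty [Preorder X] {D : Finset X} (hD : IsLowerSet (D : Set X)) {b : X} (hb : ∀ x, b ≤ x)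
    (hne : D.Nonempty) : b ∈ D := by
  obtain ⟨x, hx⟩ := hne
  exact mem_coe.mp (hD (hb x) (mem_coe.mpr hx))

/-- The mirror set `{x | c x ∈ D}` of `D` under an involution has the cardinality of `D`. -/
theorem card_filter_mirror [Fintype X] [DecidableEq X] (c : X → X) (hc : Function.Involutive c) (D : Finset X) :
    (univ.filter (fun x => c x ∈ D)).card = D.card := by
  have h : univ.filter (fun x => c x ∈ D) = D.image c := by
    ext x
    simp only [mem_filter, mem_univ, true_and, mem_image]
    constructor
    · intro hx; exact ⟨c x, hx, hc x⟩
    · rintro ⟨y, hy, rfl⟩; rw [hc y]; exact hy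
  rw [h, card_image_of_injective _ hc.injective]

/-- The greatest element is a mirror point of `D` iff the least element lies in `D` (when `c b = t`). -/
theorem top_mem_filter_mirror_iff [Fintype X] [DecidableEq X] (c : X → X) (hc : Function.Involutive c) {b t : X} (hcb : c b = t) (D : Finset X) :
    t ∈ univ.filter (fun x => c x ∈ D) ↔ b ∈ D := by
  have hct : c t = b := by rw [← hcb, hc b]
  simp [hct]

/-- Mirror points of a family avoiding the greatest element avoid the least element. -/
theorem filter_mirror_subset_erase_bot [Fintype X] [DecidableEq X] (c : X → X) {b t : X} (hcb : c b = t) {D : Finset X} (htD : t ∉ D) :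
    univ.filter (fun x => c x ∈ D) ⊆ univ.erase b := by
  intro x hx
  refine mem_erase.mpr ⟨?_, mem_univ _⟩
  rintro rfl
  exact htD (hcb ▸ (mem_filter.mp hx).2)

/-- **Monotonicity of the credit of a target point.**  For `A ⊆ A'`, `C ⊆ C'` and typed target sets `T₁, T₂ ⊆ NE`, the three
disjoint credit families `(A∖C)∩T₁`, `(C∖A)∩T₂`, `A∩C∩NE` of `(A,C)` are together contained in those of `(A',C')`. -/
theorem credits_mono [DecidableEq X] {A A' C C' T₁ T₂ NE : Finset X} (hA : A ⊆ A') (hC : C ⊆ C') (hT₁ : T₁ ⊆ NE) (hT₂ : T₂ ⊆ NE) :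
    ((A \ C) ∩ T₁).card + ((C \ A) ∩ T₂).card + (A ∩ C ∩ NE).card ≤
      ((A' \ C') ∩ T₁).card + ((C' \ A') ∩ T₂).card + (A' ∩ C' ∩ NE).card := by
  have hd12 : ∀ (A C : Finset X), Disjoint ((A \ C) ∩ T₁) ((C \ A) ∩ T₂) := by
    intro A C
    rw [disjoint_left]; intro x hx hx'
    exact (mem_sdiff.mp (mem_inter.mp hx').1).2 (mem_sdiff.mp (mem_inter.mp hx).1).1
  have hd3 : ∀ (A C : Finset X), Disjoint ((A \ C) ∩ T₁ ∪ (C \ A) ∩ T₂) (A ∩ C ∩ NE) := by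
    intro A C
    rw [disjoint_left]; intro x hx hx'
    have hAC := mem_inter.mp (mem_inter.mp hx').1
    rcases mem_union.mp hx with h | h
    · exact (mem_sdiff.mp (mem_inter.mp h).1).2 hAC.2
    · exact (mem_sdiff.mp (mem_inter.mp h).1).2 hAC.1
  have hunion : ∀ (A C : Finset X), ((A \ C) ∩ T₁).card + ((C \ A) ∩ T₂).card + (A ∩ C ∩ NE).card =
      ((A \ C) ∩ T₁ ∪ (C \ A) ∩ T₂ ∪ (A ∩ C ∩ NE)).card := by
    intro A C
    rw [card_union_of_disjoint (hd3 A C), card_union_of_disjoint (hd12 A C)]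
  rw [hunion A C, hunion A' C']
  refine card_le_card ?_
  intro x hx
  rcases mem_union.mp hx with hx | hx
  · rcases mem_union.mp hx with hx | hx
    · obtain ⟨hxAC, hxT⟩ := mem_inter.mp hx
      obtain ⟨hxA, hxC⟩ := mem_sdiff.mp hxAC
      by_cases hxC' : x ∈ C'
      · exact mem_union.mpr (Or.inr (mem_inter.mpr ⟨mem_inter.mpr ⟨hA hxA, hxC'⟩, hT₁ hxT⟩))
      · exact mem_union.mpr (Or.inl (mem_union.mpr (Or.inl (mem_inter.mpr ⟨mem_sdiff.mpr ⟨hA hxA, hxC'⟩, hxT⟩))))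
    · obtain ⟨hxCA, hxT⟩ := mem_inter.mp hx
      obtain ⟨hxC, hxA⟩ := mem_sdiff.mp hxCA
      by_cases hxA' : x ∈ A'
      · exact mem_union.mpr (Or.inr (mem_inter.mpr ⟨mem_inter.mpr ⟨hxA', hC hxC⟩, hT₂ hxT⟩))
      · exact mem_union.mpr (Or.inl (mem_union.mpr (Or.inr (mem_inter.mpr ⟨mem_sdiff.mpr ⟨hC hxC, hxA'⟩, hxT⟩))))
  · obtain ⟨hxAC, hxNE⟩ := mem_inter.mp hx
    obtain ⟨hxA, hxC⟩ := mem_inter.mp hxAC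
    exact mem_union.mpr (Or.inr (mem_inter.mpr ⟨mem_inter.mpr ⟨hA hxA, hC hxC⟩, hxNE⟩))

/-- Erasing one point from three pairwise disjoint families lowers the total count by at most one. -/
theorem card_three_le_erase_add_one [DecidableEq X] {S₁ S₂ S₃ : Finset X} (h12 : Disjoint S₁ S₂) (h13 : Disjoint S₁ S₃) (h23 : Disjoint S₂ S₃)
    (t : X) : S₁.card + S₂.card + S₃.card ≤ (S₁.erase t).card + (S₂.erase t).card + (S₃.erase t).card + 1 := by
  by_cases h1 : t ∈ S₁
  · have h2 : t ∉ S₂ := fun h => disjoint_left.mp h12 h1 h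
    have h3 : t ∉ S₃ := fun h => disjoint_left.mp h13 h1 h
    rw [erase_eq_of_notMem h2, erase_eq_of_notMem h3, ← card_erase_add_one h1]; omega
  · by_cases h2 : t ∈ S₂
    · have h3 : t ∉ S₃ := fun h => disjoint_left.mp h23 h2 h
      rw [erase_eq_of_notMem h1, erase_eq_of_notMem h3, ← card_erase_add_one h2]; omega
    · rw [erase_eq_of_notMem h1, erase_eq_of_notMem h2]
      by_cases h3 : t ∈ S₃
      · rw [← card_erase_add_one h3]; omega
      · rw [erase_eq_of_notMem h3]; omega



end Summit.CriticalPhenomena.PercolationContinuityZ3.Theorems.Coefficientwise.TwoArms
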